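import Summits.AtomisticToContinuum.Crystallization.Theorems.FrustratedLawDichotomyStrainedPatchHomLeafCalculus
import Summits.AtomisticToContinuum.Crystallization.Theorems.FrustratedLawDichotomyCollarCensusZeroRangeCut
import Summits.AtomisticToContinuum.Crystallization.Theorems.FrustratedLawDichotomyBumpRadialCertLJ

/-!
# Term calculus of the record potential `W₄₅ = effPot w₄₅ ω₄ (3/400)` for the `HomFloor` leaf replay (def-free)

decomp-a2c hand-2 g21 (crux `AperiodicFrustratedLawGap`, stmt-AtomisticToContinuum-27623; CERT-DESIGN-g44 §1–§2, §4 (d); critic rows 764/769: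
«the remaining work is the certificate data + a reflected evaluator for `W₄₅, W₄₅′, W₄₅″` bounds on rational intervals»).

Hand-1's generic leaf soundness (`…HomCentredForm.leaf_sound_box`, `…HomGram.boxSum_ge_of_gramLeaf`, `…HomLeafCalculus.gramLeaf_term_hyps`)
is stated for an ABSTRACT pair potential `W` with derivative data `W₁, W₂`.  This module supplies the CONCRETE instance every replay of the
(H) certificate must cite — the piecewise-`C²`, globally-`C¹` calculus of the record potential

  `W₄₅ r = V(r)·(1 − w₄₅ r) − (3/200)·ω₂(5r/4)`,  `V = lennardJones`, `w₄₅ = smoothstep₁((r − 3)/(3/2))`, `ω₄ r = ω₂(5r/4)`: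

* §1 the ingredients: `V′ = −r⁻¹³ + r⁻⁷` (private copy of the tree's `PhononStabilityNegative.hasDerivAt_lennardJones`, whose module sits in
  another route's cone), `V″ = 13r⁻¹⁴ − 7r⁻⁸`; the clipped cubic `smoothstep₁` is `C¹` on all of `ℝ` (derivative `6x − 6x²` inside,
  `0` outside, JOINTS INCLUDED); `w₄₅′ r = (4/9)(2r − 6)(9 − 2r)` on the window and `0` outside; the bump profile `ω₂` is `C¹` on `ℝ` (its
  polynomial branch and derivative vanish at `2`);
* §2 ★ `hasDerivAt_effPot45`: `W₄₅` is differentiable at every `r ≠ 0` with the explicit piecewise derivative, and the four REGIME FORMS of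
  `W₄₅` and `deriv W₄₅` (bump regime `r < 8/5`, pure-LJ regime `8/5 ≤ r ≤ 3`, window `3 ≤ r ≤ 9/2`, beyond `9/2` identically `0`), each valid on the
  CLOSED regime (this is where `C¹` across the joints is used);
* §3 the SQUARED-LENGTH TERM `φ(q) = W₄₅(√q)` of a leaf: `hasDerivAt_phi45` (the `hd` input of `leaf_sound_box` for EVERY term, with the single
  derivative function `φ′(q) = W₄₅′(√q)/(2√q)`), the JOINT GLUE for leaves whose length range straddles a joint (`r = 8/5, 3, 9/2`: monotonicity of
  `φ′ + M·id` on two abutting closed intervals gives it on their union — so curvature constants are only ever needed regime by regime, CERT-DESIGN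
  §4 (d) «take the max over both pieces»), and the packaged pair `term_hyps45`.  The regime-wise closed forms of `φ′` and their derivatives
  (curvature data) follow in the companion module `…StrainedPatchHomTermCalculusSq`.

All statements `[folklore]` calculus; 0 sorry; no definitions; axioms ⊆ {propext, Classical.choice, Quot.sound}.  `--supports stmt-AtomisticToContinuum-27623`.
-/

noncomputable section

namespace Summit.AtomisticToContinuum.Crystallization.Theorems.FrustratedLawDichotomyStrainedPatchHomTermCalculus

open Set Filter Topology
open Literature.MathematicalPhysics.StatisticalMechanics (lennardJones)
open Summit.AtomisticToContinuum.Crystallization.Theorems.FrustratedLawDichotomySchurCut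
  (omega₂ omega₂_of_two_le effPot corePot cutWeight smoothstep₁ w₄₅ ω₄ effPot_fourHalf_eq_zero w₄₅_eq_one)
open Summit.AtomisticToContinuum.Crystallization.Theorems.FrustratedLawDichotomyCollarCensusZeroRangeCut (smoothstep₁_eq_one)
open Summit.AtomisticToContinuum.Crystallization.Theorems.FrustratedLawDichotomyBumpAutocorrelation (w₄₅_eq_zero)

/-! ## §1. The ingredients -/

/-- `V′(r) = −r⁻¹³ + r⁻⁷` (`r ≠ 0`) — private copy of `PhononStabilityNegative.hasDerivAt_lennardJones` (that module imports the route file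
`Theses.ExcessDecayLiouville`; importing it here would put this file in that route's rebuild cone). [folklore] -/
private theorem hasDerivAt_lennardJones {r : ℝ} (hr : r ≠ 0) : HasDerivAt lennardJones (-(r⁻¹) ^ 13 + (r⁻¹) ^ 7) r := by
  have h1 : HasDerivAt (fun y : ℝ => y⁻¹) (-(r ^ 2)⁻¹) r := hasDerivAt_inv hr
  have hfun : lennardJones = fun y : ℝ => (1 / 12 : ℝ) * (y⁻¹) ^ 12 - (1 / 6 : ℝ) * (y⁻¹) ^ 6 := by
    funext y; simp [lennardJones]
  rw [hfun]
  refine (((h1.pow 12).const_mul (1 / 12 : ℝ)).sub ((h1.pow 6).const_mul (1 / 6 : ℝ))).congr_deriv ?_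
  push_cast
  field_simp
  ring

/-- `V″(r) = 13r⁻¹⁴ − 7r⁻⁸`: the derivative of `r ↦ −r⁻¹³ + r⁻⁷` (`r ≠ 0`). [folklore] -/
theorem hasDerivAt_deriv_lennardJones {r : ℝ} (hr : r ≠ 0) :
    HasDerivAt (fun y : ℝ => -(y⁻¹) ^ 13 + (y⁻¹) ^ 7) (13 * (r⁻¹) ^ 14 - 7 * (r⁻¹) ^ 8) r := by
  have h1 : HasDerivAt (fun y : ℝ => y⁻¹) (-(r ^ 2)⁻¹) r := hasDerivAt_inv hr
  refine ((h1.pow 13).neg.add (h1.pow 7)).congr_deriv ?_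
  push_cast
  field_simp
  ring

/-- The clipped cubic agrees with `3x² − 2x³` on `[0, 1]` (both clips match the polynomial at the joints). [folklore] -/
theorem smoothstep₁_eq_poly {x : ℝ} (h0 : 0 ≤ x) (h1 : x ≤ 1) : smoothstep₁ x = 3 * x ^ 2 - 2 * x ^ 3 := by
  unfold smoothstep₁
  split_ifs with ha hb
  · have : x = 0 := le_antisymm ha h0
    subst this; norm_num
  · have : x = 1 := le_antisymm h1 hb
    subst this; norm_num
  · rfl

/-- `smoothstep₁ = 0` on `(−∞, 0]`. [folklore] -/
theorem smoothstep₁_eq_zero {x : ℝ} (h : x ≤ 0) : smoothstep₁ x = 0 := by simp [smoothstep₁, h]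

/-- ★ **`smoothstep₁` is `C¹` on all of `ℝ`**: derivative `6x − 6x²` on `(0,1)` and `0` elsewhere, the joints `x = 0, 1` included
(the polynomial's derivative `6x(1 − x)` vanishes there). [folklore] -/
theorem hasDerivAt_smoothstep₁ (x : ℝ) : HasDerivAt smoothstep₁ (if 0 < x ∧ x < 1 then 6 * x - 6 * x ^ 2 else 0) x := by
  have hpoly : ∀ y : ℝ, HasDerivAt (fun y : ℝ => 3 * y ^ 2 - 2 * y ^ 3) (6 * y - 6 * y ^ 2) y := by
    intro y
    have h := ((hasDerivAt_pow 2 y).const_mul 3).sub ((hasDerivAt_pow 3 y).const_mul 2)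
    refine h.congr_deriv ?_
    push_cast; ring
  rcases lt_trichotomy x 0 with hx | rfl | hx
  · -- left of the support: locally `0`
    rw [if_neg (by intro h; linarith [h.1])]
    refine (hasDerivAt_const x (0:ℝ)).congr_of_eventuallyEq ?_
    filter_upwards [Iio_mem_nhds hx] with y hy using smoothstep₁_eq_zero (le_of_lt hy)
  · -- the joint `x = 0`
    rw [if_neg (by intro h; exact lt_irrefl _ h.1)]
    have hL : HasDerivWithinAt smoothstep₁ 0 (Iic 0) 0 :=
      (hasDerivWithinAt_const (0:ℝ) (Iic (0:ℝ)) (0:ℝ)).congr_of_mem (fun y hy => smoothstep₁_eq_zero hy) self_mem_Iic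
    have hR : HasDerivWithinAt smoothstep₁ 0 (Ici 0) 0 := by
      have hp : HasDerivWithinAt (fun y : ℝ => 3 * y ^ 2 - 2 * y ^ 3) 0 (Ici 0) 0 := by
        simpa using (hpoly 0).hasDerivWithinAt (s := Ici 0)
      refine hp.congr_of_eventuallyEq ?_ (by simp [smoothstep₁])
      have : Ico (0:ℝ) 1 ∈ 𝓝[Ici (0:ℝ)] 0 := Ico_mem_nhdsGE (by norm_num)
      filter_upwards [this] with y hy using smoothstep₁_eq_poly hy.1 hy.2.le
    have h := hL.union hR
    rw [Iic_union_Ici] at h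
    exact h.hasDerivAt univ_mem
  · rcases lt_trichotomy x 1 with hx1 | rfl | hx1
    · -- inside: locally the polynomial
      rw [if_pos ⟨hx, hx1⟩]
      refine (hpoly x).congr_of_eventuallyEq ?_
      filter_upwards [Ioo_mem_nhds hx hx1] with y hy using smoothstep₁_eq_poly hy.1.le hy.2.le
    · -- the joint `x = 1`
      rw [if_neg (by intro h; exact lt_irrefl _ h.2)]
      have hL : HasDerivWithinAt smoothstep₁ 0 (Iic 1) 1 := by
        have hp : HasDerivWithinAt (fun y : ℝ => 3 * y ^ 2 - 2 * y ^ 3) 0 (Iic 1) 1 := by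
          have := (hpoly 1).hasDerivWithinAt (s := Iic 1)
          norm_num at this
          exact this
        refine hp.congr_of_eventuallyEq ?_ (by norm_num [smoothstep₁])
        have : Ioc (0:ℝ) 1 ∈ 𝓝[Iic (1:ℝ)] 1 := Ioc_mem_nhdsLE (by norm_num)
        filter_upwards [this] with y hy using smoothstep₁_eq_poly hy.1.le hy.2
      have hR : HasDerivWithinAt smoothstep₁ 0 (Ici 1) 1 :=
        (hasDerivWithinAt_const (1:ℝ) (Ici (1:ℝ)) (1:ℝ)).congr_of_mem (fun y hy => smoothstep₁_eq_one hy) self_mem_Ici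
      have h := hL.union hR
      rw [Iic_union_Ici] at h
      exact h.hasDerivAt univ_mem
    · -- right of the window: locally `1`
      rw [if_neg (by intro h; linarith [h.2])]
      refine (hasDerivAt_const x (1:ℝ)).congr_of_eventuallyEq ?_
      filter_upwards [Ioi_mem_nhds hx1] with y hy using smoothstep₁_eq_one (le_of_lt hy)

/-- On the closed window `[3, 9/2]`: `1 − w₄₅ r = (16r³ − 180r² + 648r − 729)/27`. [folklore] -/
theorem one_sub_w₄₅_eq_poly {r : ℝ} (h1 : 3 ≤ r) (h2 : r ≤ 9 / 2) :
    1 - w₄₅ r = (16 * r ^ 3 - 180 * r ^ 2 + 648 * r - 729) / 27 := by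
  have hu0 : 0 ≤ (r - 3) / (9 / 2 - 3) := div_nonneg (by linarith) (by norm_num)
  have hu1 : (r - 3) / (9 / 2 - 3) ≤ 1 := by rw [div_le_one (by norm_num)]; linarith
  rw [show w₄₅ r = smoothstep₁ ((r - 3) / (9 / 2 - 3)) from rfl, smoothstep₁_eq_poly hu0 hu1]
  ring

/-- ★ **`w₄₅` is `C¹`**: `w₄₅′ r = (4/9)(2r − 6)(9 − 2r)` on the open window `(3, 9/2)` and `0` elsewhere, joints included. [folklore] -/
theorem hasDerivAt_w₄₅ (r : ℝ) : HasDerivAt w₄₅ (if 3 < r ∧ r < 9 / 2 then 4 / 9 * (2 * r - 6) * (9 - 2 * r) else 0) r := by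
  have hu : HasDerivAt (fun r : ℝ => (r - 3) / (9 / 2 - 3)) (1 / (9 / 2 - 3)) r := by
    simpa using ((hasDerivAt_id r).sub_const 3).div_const (9 / 2 - 3 : ℝ)
  have h := (hasDerivAt_smoothstep₁ ((r - 3) / (9 / 2 - 3))).comp r hu
  have hfun : w₄₅ = smoothstep₁ ∘ fun r : ℝ => (r - 3) / (9 / 2 - 3) := by
    funext r; rfl
  rw [hfun]
  refine h.congr_deriv ?_
  have hiff : (0 < (r - 3) / (9 / 2 - 3) ∧ (r - 3) / (9 / 2 - 3) < 1) ↔ (3 < r ∧ r < 9 / 2) := by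
    constructor
    · rintro ⟨ha, hb⟩
      rw [div_lt_one (by norm_num)] at hb
      have := (div_pos_iff_of_pos_right (by norm_num : (0:ℝ) < 9 / 2 - 3)).1 ha
      exact ⟨by linarith, by linarith⟩
    · rintro ⟨ha, hb⟩
      exact ⟨div_pos (by linarith) (by norm_num), by rw [div_lt_one (by norm_num)]; linarith⟩
  by_cases hr : 3 < r ∧ r < 9 / 2
  · rw [if_pos (hiff.2 hr), if_pos hr]; field_simp; ring
  · rw [if_neg (fun h' => hr (hiff.1 h')), if_neg hr]; simp

/-- The polynomial branch of the bump profile `ω₂` and its derivative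
`P′(x) = −(11/3)x + (33/4)x³ − (385/64)x⁴ + (231/256)x⁶ − (99/1024)x⁸ + (55/12288)x¹⁰`. [folklore] -/
theorem hasDerivAt_omega₂_poly (x : ℝ) :
    HasDerivAt (fun x : ℝ => 1 - 11 / 6 * x ^ 2 + 33 / 16 * x ^ 4 - 77 / 64 * x ^ 5 + 33 / 256 * x ^ 7 - 11 / 1024 * x ^ 9 +
        5 / 12288 * x ^ 11)
      (-(11 / 3) * x + 33 / 4 * x ^ 3 - 385 / 64 * x ^ 4 + 231 / 256 * x ^ 6 - 99 / 1024 * x ^ 8 + 55 / 12288 * x ^ 10) x := by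
  have h := ((((((hasDerivAt_const x (1:ℝ)).sub ((hasDerivAt_pow 2 x).const_mul (11 / 6))).add
    ((hasDerivAt_pow 4 x).const_mul (33 / 16))).sub ((hasDerivAt_pow 5 x).const_mul (77 / 64))).add
    ((hasDerivAt_pow 7 x).const_mul (33 / 256))).sub ((hasDerivAt_pow 9 x).const_mul (11 / 1024))).add
    ((hasDerivAt_pow 11 x).const_mul (5 / 12288))
  refine h.congr_deriv ?_
  push_cast; ring

/-- The polynomial branch of `ω₂` vanishes at the support end `x = 2` … [folklore] -/
theorem omega₂_poly_two :
    (1 - 11 / 6 * (2:ℝ) ^ 2 + 33 / 16 * 2 ^ 4 - 77 / 64 * 2 ^ 5 + 33 / 256 * 2 ^ 7 - 11 / 1024 * 2 ^ 9 + 5 / 12288 * 2 ^ 11) = 0 := by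
  norm_num

/-- … and so does its derivative (`ω₂` is `C¹` across the support end). [folklore] -/
theorem omega₂_dpoly_two :
    (-(11 / 3) * (2:ℝ) + 33 / 4 * 2 ^ 3 - 385 / 64 * 2 ^ 4 + 231 / 256 * 2 ^ 6 - 99 / 1024 * 2 ^ 8 + 55 / 12288 * 2 ^ 10) = 0 := by
  norm_num

/-- `ω₂` agrees with its polynomial branch on the CLOSED support `(−∞, 2]`. [folklore] -/
theorem omega₂_eq_poly {x : ℝ} (hx : x ≤ 2) :
    omega₂ x = 1 - 11 / 6 * x ^ 2 + 33 / 16 * x ^ 4 - 77 / 64 * x ^ 5 + 33 / 256 * x ^ 7 - 11 / 1024 * x ^ 9 + 5 / 12288 * x ^ 11 := by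
  rcases lt_or_eq_of_le hx with h | rfl
  · simp [omega₂, h]
  · rw [omega₂_of_two_le le_rfl, omega₂_poly_two]

/-- ★ **`ω₂` is `C¹` on `ℝ`**: derivative `P′(x)` for `x < 2`, `0` for `x ≥ 2` (joint included: `P(2) = P′(2) = 0`). [folklore] -/
theorem hasDerivAt_omega₂ (x : ℝ) :
    HasDerivAt omega₂ (if x < 2 then -(11 / 3) * x + 33 / 4 * x ^ 3 - 385 / 64 * x ^ 4 + 231 / 256 * x ^ 6 - 99 / 1024 * x ^ 8 +
      55 / 12288 * x ^ 10 else 0) x := by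
  rcases lt_trichotomy x 2 with hx | rfl | hx
  · rw [if_pos hx]
    refine (hasDerivAt_omega₂_poly x).congr_of_eventuallyEq ?_
    filter_upwards [Iio_mem_nhds hx] with y hy using omega₂_eq_poly (le_of_lt hy)
  · rw [if_neg (lt_irrefl _)]
    have hL : HasDerivWithinAt omega₂ 0 (Iic 2) 2 := by
      have hp := (hasDerivAt_omega₂_poly 2).hasDerivWithinAt (s := Iic 2)
      rw [omega₂_dpoly_two] at hp
      exact hp.congr_of_mem (fun y hy => omega₂_eq_poly hy) self_mem_Iic
    have hR : HasDerivWithinAt omega₂ 0 (Ici 2) 2 :=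
      (hasDerivWithinAt_const (2:ℝ) (Ici (2:ℝ)) (0:ℝ)).congr_of_mem (fun y hy => omega₂_of_two_le hy) self_mem_Ici
    have h := hL.union hR
    rw [Iic_union_Ici] at h
    exact h.hasDerivAt univ_mem
  · rw [if_neg (not_lt.2 hx.le)]
    refine (hasDerivAt_const x (0:ℝ)).congr_of_eventuallyEq ?_
    filter_upwards [Ioi_mem_nhds hx] with y hy using omega₂_of_two_le (le_of_lt hy)

/-- `ω₄ r = ω₂(5r/4)` is `C¹`: `ω₄′ r = (5/4)·ω₂′(5r/4)`. [folklore] -/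
theorem hasDerivAt_ω₄ (r : ℝ) :
    HasDerivAt ω₄ (5 / 4 * (if 5 * r / 4 < 2 then -(11 / 3) * (5 * r / 4) + 33 / 4 * (5 * r / 4) ^ 3 - 385 / 64 * (5 * r / 4) ^ 4 +
      231 / 256 * (5 * r / 4) ^ 6 - 99 / 1024 * (5 * r / 4) ^ 8 + 55 / 12288 * (5 * r / 4) ^ 10 else 0)) r := by
  have hu : HasDerivAt (fun r : ℝ => 5 * r / 4) (5 / 4) r := by
    simpa using ((hasDerivAt_id r).const_mul (5:ℝ)).div_const (4:ℝ)
  have h := (hasDerivAt_omega₂ (5 * r / 4)).comp r hu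
  have hfun : ω₄ = omega₂ ∘ fun r : ℝ => 5 * r / 4 := by funext r; rfl
  rw [hfun]
  refine h.congr_deriv ?_
  ring

/-! ## §2. The record potential: global `C¹` formula and the four regime forms -/

/-- Product/sum rule for an effective potential `W = V·(1 − w) − 2A·ω`. [folklore] -/
theorem hasDerivAt_effPot {w ω : ℝ → ℝ} {A r V' w' ω' : ℝ} (hV : HasDerivAt lennardJones V' r) (hw : HasDerivAt w w' r)
    (hω : HasDerivAt ω ω' r) : HasDerivAt (effPot w ω A) (V' * (1 - w r) - lennardJones r * w' - 2 * A * ω') r := by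
  have hfun : effPot w ω A = fun r => lennardJones r * (1 - w r) - 2 * A * ω r := by
    funext r; simp [effPot, corePot]
  rw [hfun]
  refine ((hV.mul ((hasDerivAt_const r (1:ℝ)).sub hw)).sub (hω.const_mul (2 * A))).congr_deriv ?_
  simp only [Pi.sub_apply]
  ring

/-- ★★ **`W₄₅` IS `C¹` ON `(0, ∞)` WITH THE EXPLICIT PIECEWISE DERIVATIVE**
`W₄₅′ r = V′(r)·(1 − w₄₅ r) − V(r)·w₄₅′(r) − (3/160)·ω₂′(5r/4)` (`r ≠ 0`; the clip indicators are the `if`s). [folklore] -/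
theorem hasDerivAt_effPot45 {r : ℝ} (hr : r ≠ 0) :
    HasDerivAt (effPot w₄₅ ω₄ (3 / 400))
      ((-(r⁻¹) ^ 13 + (r⁻¹) ^ 7) * (1 - w₄₅ r) - lennardJones r * (if 3 < r ∧ r < 9 / 2 then 4 / 9 * (2 * r - 6) * (9 - 2 * r) else 0) -
        3 / 160 * (if 5 * r / 4 < 2 then -(11 / 3) * (5 * r / 4) + 33 / 4 * (5 * r / 4) ^ 3 - 385 / 64 * (5 * r / 4) ^ 4 +
          231 / 256 * (5 * r / 4) ^ 6 - 99 / 1024 * (5 * r / 4) ^ 8 + 55 / 12288 * (5 * r / 4) ^ 10 else 0)) r := by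
  refine (hasDerivAt_effPot (A := 3 / 400) (hasDerivAt_lennardJones hr) (hasDerivAt_w₄₅ r) (hasDerivAt_ω₄ r)).congr_deriv ?_
  ring

/-- `W₄₅` is differentiable at every `r ≠ 0`. [folklore] -/
theorem differentiableAt_effPot45 {r : ℝ} (hr : r ≠ 0) : DifferentiableAt ℝ (effPot w₄₅ ω₄ (3 / 400)) r :=
  (hasDerivAt_effPot45 hr).differentiableAt

/-- **Bump regime, value** (`r ≤ 8/5`, hence `r ≤ 3`): `W₄₅ r = V(r) − (3/200)·P(5r/4)`. [folklore] -/
theorem effPot45_eq_bump {r : ℝ} (h : r ≤ 8 / 5) :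
    effPot w₄₅ ω₄ (3 / 400) r = lennardJones r - 3 / 200 * (1 - 11 / 6 * (5 * r / 4) ^ 2 + 33 / 16 * (5 * r / 4) ^ 4 -
      77 / 64 * (5 * r / 4) ^ 5 + 33 / 256 * (5 * r / 4) ^ 7 - 11 / 1024 * (5 * r / 4) ^ 9 + 5 / 12288 * (5 * r / 4) ^ 11) := by
  have hw : w₄₅ r = 0 := w₄₅_eq_zero (by linarith)
  have hω : ω₄ r = _ := omega₂_eq_poly (show 5 * r / 4 ≤ 2 by linarith)
  simp only [effPot, corePot, hw, ω₄] at *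
  rw [hω]; ring

/-- **Pure-LJ regime, value** (`8/5 ≤ r ≤ 3`): `W₄₅ r = V(r)`. [folklore] -/
theorem effPot45_eq_lj {r : ℝ} (h1 : 8 / 5 ≤ r) (h2 : r ≤ 3) : effPot w₄₅ ω₄ (3 / 400) r = lennardJones r := by
  have hw : w₄₅ r = 0 := w₄₅_eq_zero h2
  have hω : ω₄ r = 0 := omega₂_of_two_le (by linarith)
  simp [effPot, corePot, hw, hω]

/-- **Window regime, value** (`3 ≤ r ≤ 9/2`): `W₄₅ r = V(r)·(16r³ − 180r² + 648r − 729)/27`. [folklore] -/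
theorem effPot45_eq_window {r : ℝ} (h1 : 3 ≤ r) (h2 : r ≤ 9 / 2) :
    effPot w₄₅ ω₄ (3 / 400) r = lennardJones r * ((16 * r ^ 3 - 180 * r ^ 2 + 648 * r - 729) / 27) := by
  have hω : ω₄ r = 0 := omega₂_of_two_le (by linarith)
  simp only [effPot, corePot, hω, mul_zero, sub_zero]
  rw [one_sub_w₄₅_eq_poly h1 h2]

/-- **Beyond the range, value** (`9/2 ≤ r`): `W₄₅ r = 0` (the tree's `effPot_fourHalf_eq_zero`). [folklore] -/
theorem effPot45_eq_far {r : ℝ} (h : 9 / 2 ≤ r) : effPot w₄₅ ω₄ (3 / 400) r = 0 := effPot_fourHalf_eq_zero _ h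

/-- ★ **Bump regime, derivative** on the CLOSED regime `0 < r ≤ 8/5`: `W₄₅′ r = V′(r) − (3/160)·P′(5r/4)` (at `r = 8/5` because `P′(2) = 0`). [folklore] -/
theorem deriv_effPot45_bump {r : ℝ} (h0 : 0 < r) (h : r ≤ 8 / 5) :
    deriv (effPot w₄₅ ω₄ (3 / 400)) r = (-(r⁻¹) ^ 13 + (r⁻¹) ^ 7) - 3 / 160 * (-(11 / 3) * (5 * r / 4) + 33 / 4 * (5 * r / 4) ^ 3 -
      385 / 64 * (5 * r / 4) ^ 4 + 231 / 256 * (5 * r / 4) ^ 6 - 99 / 1024 * (5 * r / 4) ^ 8 + 55 / 12288 * (5 * r / 4) ^ 10) := by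
  rw [(hasDerivAt_effPot45 h0.ne').deriv, w₄₅_eq_zero (by linarith), if_neg (by intro h'; linarith [h'.1])]
  rcases lt_or_eq_of_le h with hlt | rfl
  · rw [if_pos (by linarith)]; ring
  · norm_num

/-- ★ **Pure-LJ regime, derivative** on the closed regime `8/5 ≤ r ≤ 3`: `W₄₅′ r = V′(r) = −r⁻¹³ + r⁻⁷`. [folklore] -/
theorem deriv_effPot45_lj {r : ℝ} (h1 : 8 / 5 ≤ r) (h2 : r ≤ 3) :
    deriv (effPot w₄₅ ω₄ (3 / 400)) r = -(r⁻¹) ^ 13 + (r⁻¹) ^ 7 := by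
  rw [(hasDerivAt_effPot45 (by linarith : r ≠ 0)).deriv, w₄₅_eq_zero h2, if_neg (by intro h'; linarith [h'.1]),
    if_neg (by linarith)]
  ring

/-- ★ **Window regime, derivative** on the closed window `3 ≤ r ≤ 9/2`:
`W₄₅′ r = V′(r)·(16r³ − 180r² + 648r − 729)/27 + V(r)·(16r² − 120r + 216)/9` (the second factor is `(1 − w₄₅)′ = −w₄₅′`; at the joints
`w₄₅′ = 0`). [folklore] -/
theorem deriv_effPot45_window {r : ℝ} (h1 : 3 ≤ r) (h2 : r ≤ 9 / 2) :
    deriv (effPot w₄₅ ω₄ (3 / 400)) r = (-(r⁻¹) ^ 13 + (r⁻¹) ^ 7) * ((16 * r ^ 3 - 180 * r ^ 2 + 648 * r - 729) / 27) +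
      lennardJones r * ((16 * r ^ 2 - 120 * r + 216) / 9) := by
  rw [(hasDerivAt_effPot45 (by linarith : r ≠ 0)).deriv, one_sub_w₄₅_eq_poly h1 h2, if_neg (show ¬ 5 * r / 4 < 2 by linarith)]
  by_cases hr : 3 < r ∧ r < 9 / 2
  · rw [if_pos hr]; ring
  · rw [if_neg hr]
    rcases not_and_or.1 hr with h3 | h4
    · have : r = 3 := le_antisymm (not_lt.1 h3) h1
      subst this; norm_num
    · have : r = 9 / 2 := le_antisymm h2 (not_lt.1 h4)
      subst this; norm_num

/-- ★ **Beyond the range, derivative** (`9/2 ≤ r`): `W₄₅′ r = 0`. [folklore] -/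
theorem deriv_effPot45_far {r : ℝ} (h : 9 / 2 ≤ r) : deriv (effPot w₄₅ ω₄ (3 / 400)) r = 0 := by
  rw [(hasDerivAt_effPot45 (by linarith : r ≠ 0)).deriv, w₄₅_eq_one h, if_neg (by intro h'; linarith [h'.2]),
    if_neg (show ¬ 5 * r / 4 < 2 by linarith)]
  ring

/-! ## §3. The squared-length term `φ(q) = W₄₅(√q)`: derivative, joint glue, packaged hypotheses -/

/-- ★★ **THE `hd` INPUT FOR EVERY TERM**: `φ(q) = W₄₅(√q)` has derivative `φ′(q) = W₄₅′(√q)/(2√q)` at every `q > 0`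
(`W₄₅′ = deriv W₄₅`, any regime, joints included). [folklore] -/
theorem hasDerivAt_phi45 {q : ℝ} (hq : 0 < q) :
    HasDerivAt (fun q => effPot w₄₅ ω₄ (3 / 400) (Real.sqrt q))
      (deriv (effPot w₄₅ ω₄ (3 / 400)) (Real.sqrt q) / (2 * Real.sqrt q)) q :=
  FrustratedLawDichotomyStrainedPatchHomLeafCalculus.hasDerivAt_comp_sqrt hq.ne'
    (differentiableAt_effPot45 (Real.sqrt_pos.2 hq).ne').hasDerivAt

/-- ★ **JOINT GLUE**: monotone on `[a, c]` and on `[c, b]` ⟹ monotone on `[a, b]` (for `φ′ + M·id` across a regime joint, with `M` the max of the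
two pieces' curvature constants). [folklore] -/
theorem monotoneOn_Icc_of_pieces {f : ℝ → ℝ} {a c b : ℝ} (hac : a ≤ c) (hcb : c ≤ b) (h₁ : MonotoneOn f (Icc a c))
    (h₂ : MonotoneOn f (Icc c b)) : MonotoneOn f (Icc a b) := by
  have h := h₁.union_right h₂ (isGreatest_Icc hac) (isLeast_Icc hcb)
  rwa [Icc_union_Icc_eq_Icc hac hcb] at h

/-- Raising the constant keeps monotonicity: `φ′ + M·id` monotone and `M ≤ M′` ⟹ `φ′ + M′·id` monotone (so the two pieces of a straddling leaf may
be glued at `M′ = max`). [folklore] -/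
theorem monotoneOn_add_mul_mono {g : ℝ → ℝ} {s : Set ℝ} {M M' : ℝ} (h : MonotoneOn (fun t => g t + M * t) s) (hM : M ≤ M') :
    MonotoneOn (fun t => g t + M' * t) s := by
  intro x hx y hy hxy
  have h1 := h hx hy hxy
  have h2 : (M' - M) * x ≤ (M' - M) * y := mul_le_mul_of_nonneg_left hxy (by linarith)
  simp only at h1 ⊢
  nlinarith

/-- ★★ **PACKAGED TERM HYPOTHESES** (the `hd`/`hmono` pair of `…HomCentredForm.leaf_sound_box` / `…HomGram.boxSum_ge_of_gramLeaf` for a term with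
squared-length range `[a, b]`, `a > 0`): differentiability is automatic; only the monotonicity of `φ′ + M·id` on `[a, b]` has to be supplied
(regime by regime from the companion module, glued by `monotoneOn_Icc_of_pieces`). [folklore] -/
theorem term_hyps45 {a b M : ℝ} (ha : 0 < a)
    (hmono : MonotoneOn (fun t => deriv (effPot w₄₅ ω₄ (3 / 400)) (Real.sqrt t) / (2 * Real.sqrt t) + M * t) (Icc a b)) :
    (∀ t ∈ Icc a b, HasDerivAt (fun q => effPot w₄₅ ω₄ (3 / 400) (Real.sqrt q))
        (deriv (effPot w₄₅ ω₄ (3 / 400)) (Real.sqrt t) / (2 * Real.sqrt t)) t) ∧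
      MonotoneOn (fun t => deriv (effPot w₄₅ ω₄ (3 / 400)) (Real.sqrt t) / (2 * Real.sqrt t) + M * t) (Icc a b) :=
  ⟨fun _ ht => hasDerivAt_phi45 (ha.trans_le ht.1), hmono⟩

end Summit.AtomisticToContinuum.Crystallization.Theorems.FrustratedLawDichotomyStrainedPatchHomTermCalculus

end
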